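import Literature.Geometry.Lorentzian.BilinPullbackEstimates
import HarnessLib

/-!
# Route ZeroEnergyKerrOrBomb · crux `StationaryLimitReduction` (stmt-FinalStateConjecture-10021), line
# `symplectic-dual-of-the-bomb` — `Cᵏ` convergence to zero is preserved by pulling back along a
# TIME-EQUIVARIANT map onto TRANSLATING compact pieces (analytic core of `stub_chartTransfer`)

Helper file (`--supports stmt-FinalStateConjecture-10021`; registered helper
`equivariantPullback_tendsto_zero`) from the lead's wave-1 stub-worker for `stub_chartTransfer` (lead
prover-line-stmt-FinalStateConjecture-10021-a1-0, 2026-08-16). In the chart transfer the new hole chart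
is `ψᵢ ∘ Φᵢ` with `Φᵢ = (Λᵢ, cᵢ) ∘ Θᵢ ∘ (Λᵢ, cᵢ)⁻¹` equivariant, `Φᵢ (x + t v) = Φᵢ x + t w`
(`v = Λᵢ e₀`, `w = cᵢ Λᵢ e₀`), and on a Kerr–Schild slab its metric deviation is the coordinate
pullback `bilinPullback Φᵢ B` of the old deviation `B` (`BilinPullbackEstimates.lean`). The truncated
Kerr–Schild slabs `{t* = τ, r₊ < r ≤ R}` are the translates `K + τ v` of ONE relatively compact piece,
and `Φᵢ(K + τ v) = Φᵢ(K) + τ w` sweeps a window of adapted slabs whose times go to `+∞`. This file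
proves the resulting convergence statement in normed-space generality:

* `iteratedFDeriv_apply_add_smul_of_equivariant` — derivatives of order `≥ 1` of an equivariant map
  are invariant under the translation (so ONE compact piece bounds them on all translates: this is
  what the collar `r₀ < r₊` of `IsKerrCharted` buys, `K = {t* = 0, r₊ ≤ r ≤ R} ⊆ {r > r₀}`);
* `tendsto_supCkENorm_bilinPullback_translate` — if the `Cᵏ` sup norms of `B` over the images
  `Φ(K + T i • v)` tend to `0` along a filter, so do the `Cᵏ` sup norms of `bilinPullback Φ B` over
  `K + T i • v` (the tree's `norm_iteratedFDeriv_bilinPullback_le`, Leibniz + Faà di Bruno, with the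
  uniform bound of the previous item);
* `supCkENorm_le_iSup₂_of_subset_iUnion₂`, `tendsto_iSup_window_of_tendsto` — bookkeeping: a sup norm
  over a set covered by a family is at most the supremum of the sup norms, and
  `⨆_{σ ∈ [cτ + m, cτ + M']} g σ → 0` as `τ → ∞` when `g → 0` and `c > 0`;
* `image_translate_subset_window` — `Φ(K + τ v)` lies in a window `{time ∈ [cτ + m, cτ + M'], rad ≤ R̃}`
  for any time function with `time (u + t w) = time u + c t` and any translation-invariant radius
  dominated by a continuous function (compactness of `Φ(K)`);
* `equivariantPullback_tendsto_zero` (registered, binder-free) — the assembled statement: truncated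
  `Cᵏ` convergence `sup_{time = σ, rad ≤ R̃} → 0` (`σ → ∞`, every `R̃`) of `B` implies
  `supCkENorm (K + τ v) k (bilinPullback Φ B) → 0` (`τ → ∞`).

Elementary real analysis over Mathlib (`iteratedFDeriv_comp_add_right`, `iteratedFDeriv_add_apply`,
`Filter.EventuallyEq.iteratedFDeriv`); no named fact, nothing restated. References: Petersen 2006,
Ch. 10, §3.2 (componentwise `Cᵏ` convergence of tensors is chart independent); DHRT arXiv:2104.08222,
§1 (truncated slab norms).
-/

-- every `Summit.FinalStateConjecture.FinalStateConjecture.…` name repeats the summit = sub-problem segment (D-0017 layout)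
set_option linter.dupNamespace false

noncomputable section

open scoped Topology ENNReal Nat
open Set Filter Function

namespace Summit.FinalStateConjecture.FinalStateConjecture.Theorems.SymplecticDualOfTheBomb

open Literature.Geometry.Lorentzian

section SupNorm

variable {F G : Type*} [NormedAddCommGroup F] [NormedSpace ℝ F] [NormedAddCommGroup G]
  [NormedSpace ℝ G]

/-- A `Cᵏ` sup norm over a set covered by a family of sets is at most the supremum of the sup norms
over the members. [folklore] -/
theorem supCkENorm_le_iSup₂_of_subset_iUnion₂ {ι : Type*} {S : Set F} {W : Set ι} {P : ι → Set F}
    (h : S ⊆ ⋃ i ∈ W, P i) (k : ℕ) (f : F → G) :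
    supCkENorm S k f ≤ ⨆ i ∈ W, supCkENorm (P i) k f := by
  refine supCkENorm_le_of_forall_le fun m hm x hx ↦ ?_
  obtain ⟨i, hi, hxi⟩ := mem_iUnion₂.1 (h hx)
  exact (enorm_iteratedFDeriv_le_supCkENorm hm hxi f).trans
    (le_iSup₂_of_le (f := fun i _ ↦ supCkENorm (P i) k f) i hi le_rfl)

end SupNorm

/-- **Moving windows.** If `g σ → 0` as `σ → ∞` and `c > 0`, then `⨆_{σ ∈ [cτ + m, cτ + M']} g σ → 0`
as `τ → ∞`. [folklore] -/
theorem tendsto_iSup_window_of_tendsto {g : ℝ → ℝ≥0∞} (hg : Tendsto g atTop (𝓝 0)) {c : ℝ}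
    (hc : 0 < c) (m M' : ℝ) :
    Tendsto (fun τ : ℝ ↦ ⨆ σ ∈ Icc (c * τ + m) (c * τ + M'), g σ) atTop (𝓝 0) := by
  rw [ENNReal.tendsto_nhds_zero]
  intro ε hε
  obtain ⟨σ₀, hσ₀⟩ := eventually_atTop.1 (ENNReal.tendsto_nhds_zero.1 hg ε hε)
  filter_upwards [eventually_ge_atTop ((σ₀ - m) / c)] with τ hτ
  refine iSup₂_le fun σ hσ ↦ hσ₀ σ ?_
  have h1 : σ₀ - m ≤ c * τ := by rwa [div_le_iff₀ hc, mul_comm] at hτ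
  linarith [hσ.1]

section Equivariant

variable {E F : Type*} [NormedAddCommGroup E] [NormedSpace ℝ E] [NormedAddCommGroup F]
  [NormedSpace ℝ F]

/-- **Derivatives of an equivariant map are translation invariant.** If `θ (x + t v) = θ x + t w` on
an open set `s` invariant under `x ↦ x + t v`, and `θ` is `C^N` on `s`, then for `1 ≤ i ≤ N` and
`x ∈ s`, `Dⁱθ (x + t v) = Dⁱθ (x)` (the two functions `y ↦ θ (y + t v)` and `y ↦ θ y + t w` agree near
`x`, and a constant has no derivatives of positive order). [folklore] -/
theorem iteratedFDeriv_apply_add_smul_of_equivariant {θ : E → F} {s : Set E} (hs : IsOpen s)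
    {v : E} {w : F} (hθv : ∀ x ∈ s, ∀ t : ℝ, θ (x + t • v) = θ x + t • w) {N : WithTop ℕ∞}
    (hθ : ContDiffOn ℝ N θ s) {i : ℕ} (hi : 1 ≤ i) (hiN : (i : WithTop ℕ∞) ≤ N) {x : E}
    (hx : x ∈ s) (t : ℝ) :
    iteratedFDeriv ℝ i θ (x + t • v) = iteratedFDeriv ℝ i θ x := by
  have h1 : iteratedFDeriv ℝ i θ (x + t • v) = iteratedFDeriv ℝ i (fun y ↦ θ (y + t • v)) x := by
    rw [iteratedFDeriv_comp_add_right]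
  have h2 : (fun y ↦ θ (y + t • v)) =ᶠ[𝓝 x] (fun y ↦ θ y + t • w) := by
    filter_upwards [hs.mem_nhds hx] with y hy using hθv y hy t
  have h3 : iteratedFDeriv ℝ i (fun y ↦ θ y + t • w) x = iteratedFDeriv ℝ i θ x := by
    have hθx : ContDiffAt ℝ i θ x := (hθ.of_le hiN).contDiffAt (hs.mem_nhds hx)
    have hc : ContDiffAt ℝ i (fun _ : E ↦ t • w) x := contDiffAt_const
    have h := iteratedFDeriv_add_apply hθx hc
    rw [show (fun y ↦ θ y + t • w) = θ + fun _ ↦ t • w from rfl, h,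
      iteratedFDeriv_const_of_ne (by omega : i ≠ 0), Pi.zero_apply, add_zero]
  rw [h1, (h2.iteratedFDeriv ℝ i).eq_of_nhds, h3]

/-- **Pulling back along a fixed equivariant map is continuous for `Cᵏ` convergence to zero on
translating compact pieces.** Let `θ` be `C^{k+1}` on an open set `s` invariant under `x ↦ x + t v`,
with `θ (x + t v) = θ x + t w` there; `K ⊆ s` compact; `B` a field of bilinear forms, `Cᵏ` on an open
`t ⊇ θ(s)`. If the `Cᵏ` sup norms of `B` over `θ(K + Tᵢ v)` tend to `0` along `l`, then so do the
`Cᵏ` sup norms of `bilinPullback θ B` over `K + Tᵢ v` (linear `Cᵏ` estimate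
`norm_iteratedFDeriv_bilinPullback_le` with the derivative bounds of `θ` on `K`, valid on every
translate by `iteratedFDeriv_apply_add_smul_of_equivariant`). Petersen 2006, Ch. 10, §3.2. [folklore] -/
theorem tendsto_supCkENorm_bilinPullback_translate {ι : Type*} {l : Filter ι} {θ : E → F} {s : Set E}
    (hs : IsOpen s) {k : ℕ} (hθ : ContDiffOn ℝ (k + 1) θ s) {v : E} {w : F}
    (hsv : ∀ x ∈ s, ∀ t : ℝ, x + t • v ∈ s) (hθv : ∀ x ∈ s, ∀ t : ℝ, θ (x + t • v) = θ x + t • w)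
    {K : Set E} (hK : IsCompact K) (hKs : K ⊆ s) {B : F → F →L[ℝ] F →L[ℝ] ℝ} {t : Set F}
    (ht : IsOpen t) (hB : ContDiffOn ℝ k B t) (hst : MapsTo θ s t) (T : ι → ℝ)
    (hlim : Tendsto (fun i ↦ supCkENorm (θ '' ((fun x ↦ x + T i • v) '' K)) k B) l (𝓝 0)) :
    Tendsto (fun i ↦ supCkENorm ((fun x ↦ x + T i • v) '' K) k (bilinPullback θ B)) l (𝓝 0) := by
  obtain ⟨Θ, hΘ₁, hΘ⟩ := exists_bound_iteratedFDeriv_of_isCompact hs hθ hK hKs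
  set A : ℝ := 4 ^ k * k ! * Θ ^ (k + 2) with hA
  have hfin : ∀ᶠ i in l, supCkENorm (θ '' ((fun x ↦ x + T i • v) '' K)) k B < 1 :=
    (tendsto_order.1 hlim).2 1 zero_lt_one
  have hN : Tendsto (fun i ↦ (supCkENorm (θ '' ((fun x ↦ x + T i • v) '' K)) k B).toReal) l (𝓝 0) := by
    have h := (ENNReal.tendsto_toReal ENNReal.zero_ne_top).comp hlim
    rw [ENNReal.toReal_zero] at h
    exact h
  have hupper : Tendsto
      (fun i ↦ ENNReal.ofReal (A * (supCkENorm (θ '' ((fun x ↦ x + T i • v) '' K)) k B).toReal))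
      l (𝓝 0) := by
    have h := ENNReal.tendsto_ofReal (hN.const_mul A)
    simpa using h
  refine tendsto_of_tendsto_of_tendsto_of_le_of_le' tendsto_const_nhds hupper
    (Eventually.of_forall fun _ ↦ zero_le) ?_
  filter_upwards [hfin] with i hfi
  have hfin' : supCkENorm (θ '' ((fun x ↦ x + T i • v) '' K)) k B ≠ ⊤ :=
    (hfi.trans ENNReal.one_lt_top).ne
  refine supCkENorm_le_ofReal fun m hm x hx ↦ ?_
  obtain ⟨x₀, hx₀, rfl⟩ := hx
  have hxs : x₀ + T i • v ∈ s := hsv x₀ (hKs hx₀) (T i)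
  have hθk : ContDiffOn ℝ ((k + 1 : ℕ) : WithTop ℕ∞) θ s := by exact_mod_cast hθ
  refine norm_iteratedFDeriv_bilinPullback_le hs ht hθ hB hst hxs hΘ₁ ENNReal.toReal_nonneg
    (fun j h1 hj ↦ ?_) (fun j hj ↦ ?_) hm
  · rw [iteratedFDeriv_apply_add_smul_of_equivariant hs hθv hθk h1 (by exact_mod_cast hj) (hKs hx₀)]
    exact hΘ j h1 hj x₀ hx₀
  · exact norm_iteratedFDeriv_le_toReal_supCkENorm hj
      (mem_image_of_mem θ (mem_image_of_mem (fun x ↦ x + T i • v) hx₀)) _ hfin'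

/-- **Windows.** For `K ⊆ s` compact, `θ` continuous on `s` and equivariant (`θ (x + t v) = θ x + t w`),
a continuous `time` with `time (u + t w) = time u + c t`, and a translation-invariant `rad` dominated
by a continuous function, the translates `θ(K + τ v) = θ(K) + τ w` lie in windows
`{time ∈ [cτ + m, cτ + M'], rad ≤ R̃}` with `m, M', R̃` independent of `τ`. [folklore] -/
theorem image_translate_subset_window {θ : E → F} {s K : Set E} (hK : IsCompact K) (hKs : K ⊆ s)
    (hθc : ContinuousOn θ s) {v : E} {w : F}
    (hθv : ∀ x ∈ s, ∀ t : ℝ, θ (x + t • v) = θ x + t • w)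
    {time : F → ℝ} (htc : Continuous time) {c : ℝ} (htime : ∀ u : F, ∀ t : ℝ, time (u + t • w) = time u + c * t)
    {rad bound : F → ℝ} (hbc : Continuous bound) (hrb : ∀ u, rad u ≤ bound u)
    (hrad : ∀ u : F, ∀ t : ℝ, rad (u + t • w) = rad u) :
    ∃ m M' Rt : ℝ, ∀ τ : ℝ, θ '' ((fun x ↦ x + τ • v) '' K) ⊆
      {u | time u ∈ Icc (c * τ + m) (c * τ + M') ∧ rad u ≤ Rt} := by
  have hK' : IsCompact (θ '' K) := hK.image_of_continuousOn (hθc.mono hKs)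
  obtain ⟨Ct, hCt⟩ := hK'.exists_bound_of_continuousOn (f := time) htc.continuousOn
  obtain ⟨Cb, hCb⟩ := hK'.exists_bound_of_continuousOn (f := bound) hbc.continuousOn
  refine ⟨-Ct, Ct, Cb, fun τ ↦ ?_⟩
  rintro _ ⟨_, ⟨x, hx, rfl⟩, rfl⟩
  have h1 := abs_le.1 ((Real.norm_eq_abs _).symm.trans_le (hCt (θ x) (mem_image_of_mem θ hx)))
  have h2 := (le_abs_self _).trans ((Real.norm_eq_abs _).symm.trans_le (hCb (θ x) (mem_image_of_mem θ hx)))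
  simp only [mem_setOf_eq, mem_Icc]
  rw [hθv x (hKs hx) τ, htime, hrad]
  exact ⟨⟨by linarith [h1.1], by linarith [h1.2]⟩, (hrb _).trans h2⟩

/-- **Assembly.** Under the hypotheses of `tendsto_supCkENorm_bilinPullback_translate` and
`image_translate_subset_window` with `c > 0`: if for every `R̃` the `Cᵏ` sup norms of `B` over the
truncated level sets `{u ∈ t | time u = σ, rad u ≤ R̃}` tend to `0` as `σ → ∞`, then
`supCkENorm (K + τ v) k (bilinPullback θ B) → 0` as `τ → ∞`. [folklore] -/
theorem tendsto_supCkENorm_bilinPullback_translate_of_window {θ : E → F} {s : Set E}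
    (hs : IsOpen s) {k : ℕ} (hθ : ContDiffOn ℝ (k + 1) θ s) {v : E} {w : F}
    (hsv : ∀ x ∈ s, ∀ t : ℝ, x + t • v ∈ s) (hθv : ∀ x ∈ s, ∀ t : ℝ, θ (x + t • v) = θ x + t • w)
    {K : Set E} (hK : IsCompact K) (hKs : K ⊆ s) {B : F → F →L[ℝ] F →L[ℝ] ℝ} {t : Set F}
    (ht : IsOpen t) (hB : ContDiffOn ℝ k B t) (hst : MapsTo θ s t)
    {time : F → ℝ} (htc : Continuous time) {c : ℝ} (hc : 0 < c)
    (htime : ∀ u : F, ∀ r : ℝ, time (u + r • w) = time u + c * r)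
    {rad bound : F → ℝ} (hbc : Continuous bound) (hrb : ∀ u, rad u ≤ bound u)
    (hrad : ∀ u : F, ∀ r : ℝ, rad (u + r • w) = rad u)
    (hdev : ∀ Rt : ℝ, Tendsto (fun σ ↦ supCkENorm {u | u ∈ t ∧ time u = σ ∧ rad u ≤ Rt} k B) atTop (𝓝 0)) :
    Tendsto (fun τ : ℝ ↦ supCkENorm ((fun x ↦ x + τ • v) '' K) k (bilinPullback θ B)) atTop (𝓝 0) := by
  obtain ⟨m, M', Rt, hwin⟩ := image_translate_subset_window hK hKs hθ.continuousOn hθv htc htime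
    hbc hrb hrad
  refine tendsto_supCkENorm_bilinPullback_translate hs hθ hsv hθv hK hKs ht hB hst id ?_
  have hsub : ∀ τ : ℝ, θ '' ((fun x ↦ x + τ • v) '' K) ⊆
      ⋃ σ ∈ Icc (c * τ + m) (c * τ + M'), {u | u ∈ t ∧ time u = σ ∧ rad u ≤ Rt} := by
    intro τ u hu
    have hut : u ∈ t := by
      obtain ⟨x, ⟨x₀, hx₀, rfl⟩, rfl⟩ := hu
      exact hst (hsv x₀ (hKs hx₀) τ)
    obtain ⟨hti, hra⟩ := hwin τ hu
    exact mem_iUnion₂.2 ⟨time u, hti, hut, rfl, hra⟩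
  refine tendsto_of_tendsto_of_tendsto_of_le_of_le tendsto_const_nhds
    (tendsto_iSup_window_of_tendsto (hdev Rt) hc m M') (fun _ ↦ zero_le) fun τ ↦ ?_
  exact supCkENorm_le_iSup₂_of_subset_iUnion₂ (hsub τ) k B

end Equivariant

/-- **Registered helper `equivariantPullback_tendsto_zero`** (binder-free form of
`tendsto_supCkENorm_bilinPullback_translate_of_window` for `E = F = E4`): truncated `Cᵏ` convergence to
zero of a field of bilinear forms on the windows of a time function transfers to `Cᵏ` convergence to
zero of its pullback along an equivariant `C^{k+1}` map on the translates of a compact piece. [folklore] -/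
theorem equivariantPullback_tendsto_zero : ∀ (k : ℕ) (θ : E4 → E4) (s : Set E4) (v w : E4) (K : Set E4) (B : E4 → E4 →L[ℝ] E4 →L[ℝ] ℝ) (t : Set E4) (time rad bound : E4 → ℝ) (c : ℝ), IsOpen s → ContDiffOn ℝ (k + 1) θ s → (∀ x ∈ s, ∀ r : ℝ, x + r • v ∈ s) → (∀ x ∈ s, ∀ r : ℝ, θ (x + r • v) = θ x + r • w) → IsCompact K → K ⊆ s → IsOpen t → ContDiffOn ℝ k B t → Set.MapsTo θ s t → Continuous time → 0 < c → (∀ u : E4, ∀ r : ℝ, time (u + r • w) = time u + c * r) → Continuous bound → (∀ u, rad u ≤ bound u) → (∀ u : E4, ∀ r : ℝ, rad (u + r • w) = rad u) → (∀ Rt : ℝ, Filter.Tendsto (fun σ ↦ supCkENorm {u | u ∈ t ∧ time u = σ ∧ rad u ≤ Rt} k B) Filter.atTop (nhds 0)) → Filter.Tendsto (fun τ : ℝ ↦ supCkENorm ((fun x ↦ x + τ • v) '' K) k (bilinPullback θ B)) Filter.atTop (nhds 0) :=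
  fun _ _ _ _ _ _ _ _ _ _ _ _ hs hθ hsv hθv hK hKs ht hB hst htc hc htime hbc hrb hrad hdev ↦
    tendsto_supCkENorm_bilinPullback_translate_of_window hs hθ hsv hθv hK hKs ht hB hst htc hc htime
      hbc hrb hrad hdev

end Summit.FinalStateConjecture.FinalStateConjecture.Theorems.SymplecticDualOfTheBomb

end
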